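import Mathlib
import Summits.ValiantsHypothesis.ValiantsHypothesis.Theorems.NewtonUnitEquationsTwoProductsPlanarCellBlockMerge
import HarnessLib

/-!
# Crux `TwoProducts` (stmt-ValiantsHypothesis-5906), line `relation_ladder`: the residual's «NO CHEAP CLASS COVER»
# hypothesis is AUTOMATIC on shared alphabets — every class cover has `r ≥ C(m,2)·C(t+1,2)` classes

Negative lane (val-neg-1 g3, 2026-08-28; memo `NOTE-neg1g3-5906-V16-first-inhabitants.md` §2, evidence n°47/48 on
stmt-5906; the v12 audit of val-neg-1 g1, evidence n°50, made the same point on paper).  The residual laws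
`ResidualLawV12 … V16` of `Cruxes/TwoProducts/Lines/relation_ladder.lean` carry the hypothesis

  HYP2: for every cover of the additive coincidences of the letter family `A_j = supp u_j ∪ supp v_j` by `r` RELATION
  CLASSES (`ClassCover A Jc ac bc`, skeleton l.2206), `2^m (t+2)^4 < 2(m+1)(3(2+m+C(m,2))²)^r`,

i.e. «no CHEAP class cover exists» (the complement of rung R1_r).  This file shows that on the families where the first
residual inhabitants live — ONE SHARED ALPHABET, `A_j = E` for all `j` — the hypothesis excludes nothing: the SWAP
coincidences `(x at i, y at j) ~ (y at i, x at j)` (`i < j`, `x ≠ y` in `E ∪ {0}`) alone force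

  `classCover_lower_bound :  C(m,2) · C(#(E ∪ {0}), 2) ≤ r`

for EVERY class cover (each class `k` is pinned to one position pair `Jc k = {i,j}` and one unordered value pair
`{ac k i, bc k i} = {x,y}`, so at most the two orders of `(x,y)` share a class).  Numerically (`swapCount_6_209`,
`swapCount_10_32`): `329 175` classes at `(m,t) = (6,209)` and `23 760` at `(10,32)`, against the `r ≤ 4` resp. `r ≤ 2`
that would make a cover cheap there — so HYP2 holds automatically at and above the located frontier, and cannot be the
clause that removes a shared-alphabet inhabitant.  The cover hypothesis `hcov` of the theorems is the BODY of the skeleton's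
`ClassCover A Jc ac bc` VERBATIM (a `Cruxes/…/Lines` file is not importable here; `Iff.rfl` bridge checked in the seat's probe
`ProbeClassCover.lean`); nothing positive about any Theses statement is asserted; 5906 `TwoProducts` stays OPEN; VP ≠ VNP is
not touched. [folklore]
-/

namespace Summit.ValiantsHypothesis.Theorems.TwoProducts.Negative.ClassCoverBound

open Finset
open Summit.ValiantsHypothesis.ValiantsHypothesis.Theorems.NewtonUnitEquations.TwoProducts.FormalLogLinearisation (Expo)
open Summit.ValiantsHypothesis.ValiantsHypothesis.Theorems.NewtonUnitEquations.TwoProducts.PlanarCell (tuples)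

variable {m : ℕ}

/-! ### Swap tuples `Pi.single i x + Pi.single j y` (`x` at position `i`, `y` at position `j`, `0` elsewhere) -/

/-- Value of a swap tuple at its first position. [folklore] -/
theorem swap_at_i {i j : Fin m} (hij : i ≠ j) (x y : Expo) : (Pi.single i x + Pi.single j y : Fin m → Expo) i = x := by
  simp [Pi.single_eq_of_ne hij]

/-- Value of a swap tuple at its second position. [folklore] -/
theorem swap_at_j {i j : Fin m} (hij : i ≠ j) (x y : Expo) : (Pi.single i x + Pi.single j y : Fin m → Expo) j = y := by
  simp [Pi.single_eq_of_ne hij.symm]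

/-- A swap tuple vanishes off its two positions. [folklore] -/
theorem swap_of_ne {i j l : Fin m} (hi : l ≠ i) (hj : l ≠ j) (x y : Expo) :
    (Pi.single i x + Pi.single j y : Fin m → Expo) l = 0 := by
  simp [Pi.single_eq_of_ne hi, Pi.single_eq_of_ne hj]

/-- A swap tuple with values in `E ∪ {0}` is a letter tuple of the shared-alphabet family. [folklore] -/
theorem swap_mem_tuples {E : Finset Expo} {A : Fin m → Finset Expo} (hA : ∀ l, A l = E) {i j : Fin m} (hij : i ≠ j)
    {x y : Expo} (hx : x ∈ insert (0 : Expo) E) (hy : y ∈ insert (0 : Expo) E) :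
    (Pi.single i x + Pi.single j y : Fin m → Expo) ∈ tuples A := by
  unfold tuples
  rw [Fintype.mem_piFinset]
  intro l
  rw [hA l]
  by_cases hi : l = i
  · subst hi; rwa [swap_at_i hij]
  · by_cases hj : l = j
    · subst hj; rwa [swap_at_j hij]
    · rw [swap_of_ne hi hj]; exact Finset.mem_insert_self _ _

/-- The sum of a swap tuple is `x + y`. [folklore] -/
theorem sum_swap (i j : Fin m) (x y : Expo) : ∑ l, (Pi.single i x + Pi.single j y : Fin m → Expo) l = x + y := by
  simp [Finset.sum_add_distrib, Finset.sum_pi_single']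

/-- The two orders of a swap are different tuples when `x ≠ y`. [folklore] -/
theorem swap_ne {i j : Fin m} (hij : i ≠ j) {x y : Expo} (hxy : x ≠ y) :
    (Pi.single i x + Pi.single j y : Fin m → Expo) ≠ Pi.single i y + Pi.single j x := by
  intro h
  have := congrFun h i
  rw [swap_at_i hij, swap_at_i hij] at this
  exact hxy this

/-- What a class covering the swap `(x,y) ~ (y,x)` at positions `i < j` must look like: it is pinned to the position
pair and to the unordered value pair. [folklore] -/
theorem class_of_swap {E : Finset Expo} {A : Fin m → Finset Expo} (hA : ∀ l, A l = E) {r : ℕ}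
    {Jc : Fin r → Finset (Fin m)} {ac bc : Fin r → Fin m → Expo}
    (hcov : ∀ a ∈ tuples A, ∀ b ∈ tuples A, a ≠ b → ∑ j, a j = ∑ j, b j →
      ∃ k : Fin r, (∀ j, a j ≠ b j ↔ j ∈ Jc k) ∧
        ((∀ j ∈ Jc k, a j = ac k j ∧ b j = bc k j) ∨ (∀ j ∈ Jc k, a j = bc k j ∧ b j = ac k j)))
    {i j : Fin m} (hij : i < j) {x y : Expo} (hx : x ∈ insert (0 : Expo) E) (hy : y ∈ insert (0 : Expo) E)
    (hxy : x ≠ y) :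
    ∃ k : Fin r, Jc k = {i, j} ∧ ((x = ac k i ∧ y = bc k i) ∨ (x = bc k i ∧ y = ac k i)) := by
  have hne : i ≠ j := ne_of_lt hij
  obtain ⟨k, hJ, hval⟩ := hcov _ (swap_mem_tuples hA hne hx hy) _ (swap_mem_tuples hA hne hy hx)
    (swap_ne hne hxy) (by rw [sum_swap, sum_swap, add_comm])
  refine ⟨k, ?_, ?_⟩
  · ext l
    rw [← hJ l, Finset.mem_insert, Finset.mem_singleton]
    constructor
    · intro h
      by_contra hl
      rw [not_or] at hl
      exact h (by rw [swap_of_ne hl.1 hl.2, swap_of_ne hl.1 hl.2])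
    · rintro (rfl | rfl)
      · rw [swap_at_i hne, swap_at_i hne]; exact hxy
      · rw [swap_at_j hne, swap_at_j hne]; exact fun h => hxy h.symm
  · have hi : i ∈ Jc k := by rw [← hJ i, swap_at_i hne, swap_at_i hne]; exact hxy
    rcases hval with h | h
    · obtain ⟨h1, h2⟩ := h i hi
      rw [swap_at_i hne] at h1 h2
      exact Or.inl ⟨h1, h2⟩
    · obtain ⟨h1, h2⟩ := h i hi
      rw [swap_at_i hne] at h1 h2
      exact Or.inr ⟨h1, h2⟩

/-- Two ordered pairs `i < j`, `i' < j'` with the same underlying set coincide. [folklore] -/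
theorem pair_eq_of_insert_eq {i j i' j' : Fin m} (hij : i < j) (hij' : i' < j')
    (h : ({i, j} : Finset (Fin m)) = {i', j'}) : i = i' ∧ j = j' := by
  simp only [Finset.ext_iff, Finset.mem_insert, Finset.mem_singleton] at h
  have h1 := (h i).mp (Or.inl rfl)
  have h2 := (h j).mp (Or.inr rfl)
  have h3 := (h i').mpr (Or.inl rfl)
  have h4 := (h j').mpr (Or.inr rfl)
  simp only [Fin.ext_iff] at h1 h2 h3 h4 ⊢
  rw [Fin.lt_def] at hij hij'
  omega

/-- `#{(i,j) : i < j} = C(m,2)`. [folklore] -/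
theorem card_ltPairs (m : ℕ) :
    ((Finset.univ ×ˢ Finset.univ).filter fun p : Fin m × Fin m => p.1 < p.2).card = m.choose 2 := by
  have h : ((Finset.univ : Finset (Fin m)).powersetCard 2).card = m.choose 2 := by
    rw [Finset.card_powersetCard, Finset.card_univ, Fintype.card_fin]
  rw [← h]
  refine Finset.card_bij (fun p _ => ({p.1, p.2} : Finset (Fin m))) ?_ ?_ ?_
  · intro p hp
    rw [Finset.mem_filter] at hp
    rw [Finset.mem_powersetCard]
    exact ⟨Finset.subset_univ _, Finset.card_pair (ne_of_lt hp.2)⟩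
  · intro p hp p' hp' hpp
    rw [Finset.mem_filter] at hp hp'
    obtain ⟨h1, h2⟩ := pair_eq_of_insert_eq hp.2 hp'.2 hpp
    exact Prod.ext h1 h2
  · intro s hs
    rw [Finset.mem_powersetCard] at hs
    obtain ⟨a, b, hab, rfl⟩ := Finset.card_eq_two.mp hs.2
    rcases lt_or_gt_of_ne hab with hlt | hlt
    · exact ⟨(a, b), by simp [hlt], rfl⟩
    · exact ⟨(b, a), by simp [hlt], Finset.pair_comm _ _⟩

/-- `#{(x,y) ∈ S² : x ≠ y} = #S·#S − #S`. [folklore] -/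
theorem card_nePairs (S : Finset Expo) :
    ((S ×ˢ S).filter fun q : Expo × Expo => q.1 ≠ q.2).card = S.card * S.card - S.card := by
  classical
  have h := Finset.card_filter_add_card_filter_not (s := S ×ˢ S) (fun q : Expo × Expo => q.1 = q.2)
  rw [Finset.card_product] at h
  have hdiag : ((S ×ˢ S).filter fun q : Expo × Expo => q.1 = q.2) = S.diag := by
    ext ⟨a, b⟩
    simp only [Finset.mem_filter, Finset.mem_product, Finset.mem_diag]
    constructor
    · rintro ⟨⟨ha, _⟩, hab⟩; exact ⟨ha, hab⟩
    · rintro ⟨ha, hab⟩; exact ⟨⟨ha, hab ▸ ha⟩, hab⟩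
  rw [hdiag, Finset.diag_card] at h
  simp only [ne_eq]
  omega

/-- `#S·#S − #S = 2·C(#S, 2)`. [folklore] -/
theorem sq_sub_eq_two_mul_choose (s : ℕ) : s * s - s = 2 * s.choose 2 := by
  rw [Nat.choose_two_right, ← Nat.mul_sub_one]
  obtain ⟨k, hk⟩ := Nat.even_mul_pred_self s
  omega

/-- **Every class cover of a shared-alphabet family has at least `C(m,2)·C(#(E ∪ {0}), 2)` classes.** [folklore] -/
theorem classCover_lower_bound (E : Finset Expo) (A : Fin m → Finset Expo) (hA : ∀ l, A l = E) {r : ℕ}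
    (Jc : Fin r → Finset (Fin m)) (ac bc : Fin r → Fin m → Expo)
    (hcov : ∀ a ∈ tuples A, ∀ b ∈ tuples A, a ≠ b → ∑ j, a j = ∑ j, b j →
      ∃ k : Fin r, (∀ j, a j ≠ b j ↔ j ∈ Jc k) ∧
        ((∀ j ∈ Jc k, a j = ac k j ∧ b j = bc k j) ∨ (∀ j ∈ Jc k, a j = bc k j ∧ b j = ac k j))) :
    m.choose 2 * (insert (0 : Expo) E).card.choose 2 ≤ r := by
  classical
  set S := insert (0 : Expo) E with hS
  -- the index set of the swap coincidences: ordered position pairs `i < j` times ordered value pairs `x ≠ y`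
  set D : Finset ((Fin m × Fin m) × (Expo × Expo)) :=
    ((Finset.univ ×ˢ Finset.univ).filter fun p : Fin m × Fin m => p.1 < p.2) ×ˢ
      ((S ×ˢ S).filter fun q : Expo × Expo => q.1 ≠ q.2) with hDdef
  have memD : ∀ d, d ∈ D ↔ d.1.1 < d.1.2 ∧ d.2.1 ∈ S ∧ d.2.2 ∈ S ∧ d.2.1 ≠ d.2.2 := by
    intro d
    simp only [hDdef, Finset.mem_product, Finset.mem_filter, Finset.mem_univ, true_and, and_assoc]
  have hDcard : D.card = m.choose 2 * (2 * S.card.choose 2) := by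
    rw [hDdef, Finset.card_product, card_ltPairs, card_nePairs, sq_sub_eq_two_mul_choose]
  -- the class of each swap datum (by choice)
  have hex : ∀ d ∈ D, ∃ k : Fin r, Jc k = {d.1.1, d.1.2} ∧
      ((d.2.1 = ac k d.1.1 ∧ d.2.2 = bc k d.1.1) ∨ (d.2.1 = bc k d.1.1 ∧ d.2.2 = ac k d.1.1)) := by
    rintro ⟨⟨i, j⟩, ⟨x, y⟩⟩ hd
    rw [memD] at hd
    exact class_of_swap hA hcov hd.1 hd.2.1 hd.2.2.1 hd.2.2.2
  rcases Nat.eq_zero_or_pos r with rfl | hr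
  · -- no classes at all: then there is no swap datum, and the left-hand side is `0`
    have hemp : D = ∅ := by
      rw [Finset.eq_empty_iff_forall_notMem]
      intro d hd
      obtain ⟨k, -⟩ := hex d hd
      exact Fin.elim0 k
    rw [hemp, Finset.card_empty] at hDcard
    rcases Nat.mul_eq_zero.mp hDcard.symm with h | h
    · rw [h]; simp
    · have : S.card.choose 2 = 0 := by omega
      rw [this]; simp
  haveI : Nonempty (Fin r) := ⟨⟨0, hr⟩⟩
  choose! f hf using hex
  -- fibres of `f` have at most two elements
  have hfib : ∀ k ∈ D.image f, (D.filter fun d => f d = k).card ≤ 2 := by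
    intro k _
    by_cases hne : (D.filter fun d => f d = k).Nonempty
    · obtain ⟨d₀, hd₀⟩ := hne
      rw [Finset.mem_filter] at hd₀
      have key : (D.filter fun d => f d = k) ⊆
          {(d₀.1, (ac k d₀.1.1, bc k d₀.1.1)), (d₀.1, (bc k d₀.1.1, ac k d₀.1.1))} := by
        intro d hd
        rw [Finset.mem_filter] at hd
        obtain ⟨hJ0, _⟩ := hf d₀ hd₀.1
        obtain ⟨hJ, hv⟩ := hf d hd.1
        rw [hd₀.2] at hJ0
        rw [hd.2] at hJ hv
        have hlt0 : d₀.1.1 < d₀.1.2 := ((memD d₀).mp hd₀.1).1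
        have hlt : d.1.1 < d.1.2 := ((memD d).mp hd.1).1
        obtain ⟨h1, h2⟩ := pair_eq_of_insert_eq hlt hlt0 (hJ.symm.trans hJ0)
        have hd1 : d.1 = d₀.1 := Prod.ext h1 h2
        rw [Finset.mem_insert, Finset.mem_singleton]
        rw [h1] at hv
        rcases hv with ⟨ha, hb⟩ | ⟨ha, hb⟩
        · left; exact Prod.ext hd1 (Prod.ext ha hb)
        · right; exact Prod.ext hd1 (Prod.ext ha hb)
      exact (Finset.card_le_card key).trans (Finset.card_insert_le _ _)
    · rw [Finset.not_nonempty_iff_eq_empty] at hne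
      rw [hne]; simp
  have hmul := Finset.card_le_mul_card_image D 2 hfib
  have himg : (D.image f).card ≤ r := by
    calc (D.image f).card ≤ (Finset.univ : Finset (Fin r)).card := Finset.card_le_card (Finset.subset_univ _)
      _ = r := by rw [Finset.card_univ, Fintype.card_fin]
  rw [hDcard] at hmul
  have : m.choose 2 * (2 * S.card.choose 2) = 2 * (m.choose 2 * S.card.choose 2) := by ring
  rw [this] at hmul
  omega

/-- The same bound with `#(E ∪ {0}) = t + 1` made explicit (`0 ∉ E`, `#E = t`): `C(m,2)·C(t+1,2) ≤ r`. [folklore] -/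
theorem classCover_lower_bound_card {E : Finset Expo} (h0 : (0 : Expo) ∉ E) {t : ℕ} (ht : E.card = t)
    (A : Fin m → Finset Expo) (hA : ∀ l, A l = E) {r : ℕ}
    (Jc : Fin r → Finset (Fin m)) (ac bc : Fin r → Fin m → Expo)
    (hcov : ∀ a ∈ tuples A, ∀ b ∈ tuples A, a ≠ b → ∑ j, a j = ∑ j, b j →
      ∃ k : Fin r, (∀ j, a j ≠ b j ↔ j ∈ Jc k) ∧
        ((∀ j ∈ Jc k, a j = ac k j ∧ b j = bc k j) ∨ (∀ j ∈ Jc k, a j = bc k j ∧ b j = ac k j))) :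
    m.choose 2 * (t + 1).choose 2 ≤ r := by
  have h := classCover_lower_bound E A hA Jc ac bc hcov
  rwa [Finset.card_insert_of_notMem h0, ht] at h

/-- The swap count at the located residual instance `(m,t) = (6,209)`: `329 175` classes. -/
theorem swapCount_6_209 : Nat.choose 6 2 * Nat.choose (209 + 1) 2 = 329175 := by
  simp [Nat.choose_two_right]

/-- The swap count at the located residual instance `(m,t) = (10,32)`: `23 760` classes. -/
theorem swapCount_10_32 : Nat.choose 10 2 * Nat.choose (32 + 1) 2 = 23760 := by
  simp [Nat.choose_two_right]

/-- At `(6,209)` a class cover would be CHEAP only for `r ≤ 3` (`2·7·1587^4 > 2^6·211^4 ≥ 2·7·1587^3`); at `(10,32)` only for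
`r ≤ 1`.  Both are far below the swap counts, so HYP2 of the residual holds automatically there. -/
theorem cheap_threshold_6_209 :
    2 * (6 + 1) * (3 * (2 + 6 + Nat.choose 6 2) ^ 2) ^ 3 ≤ 2 ^ 6 * (209 + 2) ^ 4 ∧
      2 ^ 6 * (209 + 2) ^ 4 < 2 * (6 + 1) * (3 * (2 + 6 + Nat.choose 6 2) ^ 2) ^ 4 := by
  norm_num [Nat.choose]

/-- At `(10,32)` a class cover is cheap only for `r ≤ 1`. -/
theorem cheap_threshold_10_32 :
    2 * (10 + 1) * (3 * (2 + 10 + Nat.choose 10 2) ^ 2) ^ 1 ≤ 2 ^ 10 * (32 + 2) ^ 4 ∧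
      2 ^ 10 * (32 + 2) ^ 4 < 2 * (10 + 1) * (3 * (2 + 10 + Nat.choose 10 2) ^ 2) ^ 2 := by
  norm_num [Nat.choose]

end Summit.ValiantsHypothesis.Theorems.TwoProducts.Negative.ClassCoverBound
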